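import Literature.AlgebraicGeometry.AbelianSchemes.MFKSubfunctorOfHilbIntrinsicIff
import Literature.AlgebraicGeometry.AbelianSchemes.MFKUniversalLinearRigidification
import Literature.AlgebraicGeometry.Modules.SerreTwistOneAmplePullback
import Literature.AlgebraicGeometry.Modules.SerreTwistOneGeneratingSections
import Literature.AlgebraicGeometry.Modules.PushforwardFrameOfIsIso
import Literature.AlgebraicGeometry.Modules.ProjectiveFamilyTwistPushforward
import Literature.AlgebraicGeometry.Motives.FlatFamilyHilbertPolynomialGrassmannianPoint
import HarnessLib

/-!
# [MumfordFogartyKirwan1994] Prop. 7.3 / Prop. 7.6 — THE UNIVERSAL TRIPLE of the MFK sub-functor of a closed flat family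
# `Z₀ ⊂ 𝐏(J; H₀)`: an immersion `H ↪ H₀`, a polarised abelian scheme with level structure `P_H` over `H` whose embedding
# `P_H.A ⊂ 𝐏(J; H)` IS A LINEAR RIGIDIFICATION, and the `T`-points of `H` in INTRINSIC form

Layer `Literature/AlgebraicGeometry/ModuliOfAbelianVarieties`, namespace `Literature.AlgebraicGeometry.ModuliOfAbelianVarieties`,
universe `0` (= ★ `MFKSubfunctorOfHilb*`).  THEOREMS ONLY (no definition, no named fact, no instance, no notation, no `sorry`).
Cell `hodgecm-mathlib` (D-0151), F-DAG row F-6 → F-8 hand-over, piece **R-A** (B-p18 (g19) split 2026-08-30 10:55:54Z and «CLOSED» §;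
B-plan1 (g17) 11:06:06Z; bytes B-p09 (g16); census `B-provers/B-p09/g16/CENSUS-LITE-RA-SiegelUniversalTripleOfFlatFamily.B-p09g16.md`).
Count-neutral: HC_CM is proved only modulo the 7 printed citations until rung 0 closes — nothing here bears on a summit statement.

## The source, as printed

[MumfordFogartyKirwan1994] Ch. 7 §2, Prop. 7.3 (pp. 132–134): inside the Hilbert scheme `H₀` of `ℙ^m` (with its universal family
`Z₀ → H₀` and `2g+1` sections) there is a unique locally closed `H ⊂ H₀` such that a morphism `T → H₀` factors through `H` iff the
pulled-back family is an abelian scheme with identity `ε`, the sections are a symplectic-liftable level-`N` structure, `p₁^*𝒪(1)`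
normalised is `L^Δ(λ)³` for a polarisation `λ` of type `δ`, and `T × H⁰(𝒪(1)) → π_*𝒪(1)` is an isomorphism; Prop. 7.6 (p. 136):
the universal family `Z_H ⊂ ℙ^m × H` is then LINEARLY RIGIDIFIED (Def. 7.5, p. 130), and `H` represents linearly rigidified triples.

## What is here (one head, two bricks)

From RAW data over `H₀` — a CLOSED FLAT family `i₀ : Z₀ ⊂ 𝐏(J; H₀)` over a base locally of finite type over `ℚ` (read through
its two components `p₀ : Z₀ → H₀`, `ι₀ : Z₀ → 𝐏ⁿ_ℤ`), sections `ε₀, τ₀`, the two core binders `hII` ([MumfordFogartyKirwan1994]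
Thm. 6.14) and `hF3` (Cor. 6.8) of ★ FILE 2 `exists_isImmersion_iff_mfkSubfunctor` VERBATIM, a reindexing `κ : Fin (6^g·d) ≃ Fin (#J+1)`
and the coordinate frame `u₀ : 𝒪^{6^g·d} → (p₀)_*𝒪_{Z₀}(1)` (abstract, with its section letter `hu₀` — the verbatim output of ★
`exists_hom_freeModule_app_eq` at the coordinate sections `x_{κ k}|_{Z₀}` of `𝒪_{Z₀}(1) := twistMod ι₀ 𝒪 1`):
* §1 **`forall_fibre_exists_isAmple_pullback_twistMod_one_iso`** — the (P)-closer letter `hamp₂` of ★ FILE 2 DISCHARGED for an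
  embedded family: on every geometric fibre of an abelian scheme `A → S` sitting in a cartesian square over `Z₀ → H₀`, the restriction of
  `𝒪_{Z₀}(1)` is `𝒪(Θ)` with `Θ` ample (the fibre embeds in `𝐏ⁿ_Ω`, ★ `exists_closedImmersion_fibre`; ★ (L2)
  `exists_isAmple_nonempty_pullback_twistMod_one_iso_lineBundle_of_sq`) — [MumfordFogartyKirwan1994] Prop. 7.3, proof, step (V);
* §2 **`isLinearRigidification_comp_of_clauses`** — for a triple `P` over `T` in a cartesian square `pr : P.A → Z₀` over `b`, the
  INTRINSIC clauses (V) «`L_b` normalised `≅ (Γ_λ^*𝒫)^{⊗3}`» and (VI) «`b^*u₀ ≫ β` iso» make `pr ≫ ι₀ : P.A → 𝐏ⁿ_ℤ` a ★ (8α)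
  `IsLinearRigidification` — ★ (R3) `isLinearRigidification_of_homEquiv_pointOfSections_eq` at `L := 𝒪_{P.A}(1)`, with the global frame
  of `π_*𝒪(1)` produced from (VI) (★ (s1) `exists_frame_basisSection_eq_app_unitSectionLE_of_isIso`, reindexed along `κ`; its basis
  sections are the coordinate sections: `hu₀`, ★ `pushforwardBaseChangeHom_app_unitSectionLE`, ★ (γ1)
  `pullbackTwistHom_app_unitSectionLE_monomialSection`) and [Hartshorne1977] II Thm. 7.1 in the tree's form ★ (L1)
  `homEquiv_pointOfSections_ofFrameSystem_monomialSection_one` — [MumfordFogartyKirwan1994] Prop. 7.6;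
* §3 HEAD **`exists_siegelUniversalTriple_iff_mfkIntrinsic`** — the immersion `jH : H ↪ H₀` (★ FILE 2 + ★ FILE 1 through §1), the
  universal triple `P : PolarizedAbelianSchemeWithLevel g N δ H` WITH the unit hypothesis of its dual pair, its cartesian square
  `sqH : P.A → Z₀` over `jH` (unit `ε₀|_H`, level sections `τ₀|_H`), `P.IsLinearRigidification J (prH ≫ ι₀)` (§2 at the clauses of ★
  FILE 3 `mfkIntrinsic_of_existsUnique_comp` for `b := jH`), and the `T`-points `(∃! w, w ≫ jH = b) ↔ INT(b)` (★
  `existsUnique_comp_iff_mfkIntrinsic`) — INT(b) in the letters of ★ `MFKSubfunctorOfHilbIntrinsicIff` at `L₀ := twistMod ι₀ 𝒪 1`.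

## References
* [MumfordFogartyKirwan1994] D. Mumford, J. Fogarty, F. Kirwan, *Geometric Invariant Theory*, 3rd ed. (1994), Ch. 7 §2 Prop. 7.3
  and its proof, steps (I)–(VI) (pp. 132–134), Def. 7.5 (p. 130), Prop. 7.6 (p. 136); Ch. 6 §3 Thm. 6.14 (p. 124), §1 Cor. 6.8 (p. 118).
* [Hartshorne1977] R. Hartshorne, *Algebraic Geometry* (1977), II Thm. 7.1 (p. 150), II Prop. 5.12 (c) (p. 117), III Cor. 9.4.
* [GortzWedhorn2020] U. Görtz, T. Wedhorn, *Algebraic Geometry I*, 2nd ed. (2020), Prop. 13.66 (2) (p. 402), (13.9) (p. 387).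
-/

noncomputable section

-- Mathlib's `Over`/pull-back API and `Scheme.Modules` section API are stated across semireducible wrappers (as in ★ (8α), ★ (R3)).
set_option backward.isDefEq.respectTransparency false

open CategoryTheory CategoryTheory.Limits AlgebraicGeometry MonoidalCategory MonObj
open scoped MonObj

namespace Literature.AlgebraicGeometry.ModuliOfAbelianVarieties

open Literature.AlgebraicGeometry.AbelianSchemes Literature.AlgebraicGeometry.AbelianSchemes.AbelianSchemeOver
  Literature.AlgebraicGeometry.Motives Literature.AlgebraicGeometry.Motives.GeneratingSections
  Literature.AlgebraicGeometry.Modules Literature.AlgebraicGeometry.Modules.SerreTwist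
  Literature.AlgebraicGeometry.AbelianVarieties Literature.AlgebraicGeometry.Morphisms

/-! ## §0 Plumbing: a frame reindexed along an equivalence of index types -/

/-- `freeMap f ≫ freeMap f' = 𝟙` for a retraction `f' ∘ f = id` (checked on the cofan injections). [folklore] -/
private theorem freeMap_comp_freeMap_eq_id {X : Scheme.{0}} {W : X.Opens} {I I' : Type} (f : I → I') (f' : I' → I)
    (h : ∀ i, f' (f i) = i) :
    SheafOfModules.freeMap (R := X.ringCatSheaf.over W) f ≫ SheafOfModules.freeMap f' = 𝟙 _ :=
  Cofan.IsColimit.hom_ext (SheafOfModules.isColimitFreeCofan I) _ _ fun i => by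
    rw [SheafOfModules.freeCofan_inj, SheafOfModules.ιFree_freeMap_assoc, SheafOfModules.ιFree_freeMap, h]
    exact (Category.comp_id _).symm

/-- **A frame reindexed along an equivalence of index types**: from `e : 𝒪^{I'} ≅ E|_W` and `κ : I ≃ I'`, a frame
`e' : 𝒪^{I} ≅ E|_W` with `i`-th basis section the `κ i`-th basis section of `e` (`e' := freeMap κ ≫ e`). [folklore] -/
private theorem exists_frame_reindex {X : Scheme.{0}} {E : X.Modules} {W : X.Opens} {I I' : Type} (κ : I ≃ I')
    (e : SheafOfModules.free I' ≅ E.over W) :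
    ∃ e' : SheafOfModules.free I ≅ E.over W, ∀ i, basisSection e' i = basisSection e (κ i) := by
  refine ⟨⟨SheafOfModules.freeMap κ, SheafOfModules.freeMap κ.symm,
    freeMap_comp_freeMap_eq_id _ _ κ.symm_apply_apply, freeMap_comp_freeMap_eq_id _ _ κ.apply_symm_apply⟩ ≪≫ e,
    fun i => ?_⟩
  rw [basisSection, basisSection, Iso.trans_hom, SheafOfModules.freeHomEquiv_comp_apply,
    SheafOfModules.freeHomEquiv_freeMap, SheafOfModules.freeHomEquiv_apply]
  rfl

/-! ## §1 The (P)-closer letter for an embedded family: `𝒪(1)` is ample on every geometric fibre -/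

section Ample

variable {H₀ Z₀ : Scheme.{0}} {J : Type} (i₀ : Z₀ ⟶ projectiveSpace J H₀) [IsClosedImmersion i₀]
  {S : Scheme.{0}} (A : AbelianSchemeOver S) (pr : A.X.left ⟶ Z₀) {v : S ⟶ H₀}
  (sq : IsPullback pr A.X.hom (i₀ ≫ projectiveSpaceFst J H₀) v)

include sq in
/-- **[MumfordFogartyKirwan1994] Prop. 7.3, proof, step (V): `p₁^*𝒪(1)` is ample on every geometric fibre of an embedded family.**
For a closed family `i₀ : Z₀ ⊂ 𝐏(J; H₀)` and an abelian scheme `A → S` in a cartesian square `pr : A → Z₀` over `v : S → H₀`, the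
restriction of `pr^*𝒪_{Z₀}(1)` (`𝒪_{Z₀}(1) := twistMod (i₀ ≫ pr₂) 𝒪 1`) to the fibre `A_s` over a field point `s : Spec Ω → S` is the
line bundle `𝒪(Θ)` of an AMPLE Cartier divisor `Θ`: the fibre embeds in `𝐏ⁿ_Ω` by a closed immersion `ιK` over the square
`A_s → Z₀ → 𝐏ⁿ_ℤ = ιK ≫ (𝐏ⁿ_Ω → 𝐏ⁿ_ℤ)` (★ `exists_closedImmersion_fibre` on the pasted square), and ★ (L2)
`exists_isAmple_nonempty_pullback_twistMod_one_iso_lineBundle_of_sq`.  This is the `hamp₂` letter of ★ FILE 2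
`exists_isImmersion_iff_mfkSubfunctor`, discharged. [cite: MumfordFogartyKirwan1994, Ch. 7 §2 Prop. 7.3, proof, step (V) (p. 134)]
[cite: GortzWedhorn2020, Prop. 13.66 (2) (p. 402) and (13.9) (p. 387)] [cite: Hartshorne1977, II Prop. 5.12 (c) (p. 117)] -/
theorem forall_fibre_exists_isAmple_pullback_twistMod_one_iso ⦃Ω : Type⦄ [Field Ω] [IsAlgClosed Ω] (s : Spec (.of Ω) ⟶ S) :
    ∃ Θ : CartierDivisor (A.fibre s).toAbelianVariety.X.left, Θ.IsAmple ∧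
      Nonempty ((Scheme.Modules.pullback (X := (A.fibre s).toAbelianVariety.X.left) (pullback.fst A.X.hom s)).obj
        ((Scheme.Modules.pullback pr).obj
          (twistMod (i₀ ≫ pullback.snd (terminal.from H₀) (terminal.from (projectiveSpaceInt J))) (unitModule Z₀) 1)) ≅
        A.lineBundleOfDivisor s Θ) := by
  letI : Algebra intU.{0} Ω := ULift.algebra' ℤ Ω
  -- the fibre `X₀ = A ×_S Spec Ω`, its maps to `Z₀` and `Spec Ω`
  let k : (A.fibre s).toAbelianVariety.X.left ⟶ Z₀ := pullback.fst A.X.hom s ≫ pr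
  let f₀ : (A.fibre s).toAbelianVariety.X.left ⟶ Spec (.of Ω) := pullback.snd A.X.hom s
  -- the pasted cartesian square over `s ≫ v`
  have H : IsPullback k f₀ (i₀ ≫ projectiveSpaceFst J H₀) (s ≫ v) :=
    (IsPullback.of_hasPullback A.X.hom s).paste_horiz sq
  -- the fibre embeds in `𝐏ⁿ_Ω`
  obtain ⟨ιK, hιK, -, hsq⟩ := exists_closedImmersion_fibre i₀ (K := Ω) H
  haveI := hιK
  obtain ⟨Θ, hΘ, ⟨φ⟩⟩ := exists_isAmple_nonempty_pullback_twistMod_one_iso_lineBundle_of_sq intU.{0} Ω k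
    (i₀ ≫ pullback.snd (terminal.from H₀) (terminal.from (projectiveSpaceInt J))) ιK
    (by simpa only [Category.assoc] using hsq)
  exact ⟨Θ, hΘ, ⟨(Scheme.Modules.pullbackComp (pullback.fst A.X.hom s) pr).app _ ≪≫ φ⟩⟩

end Ample

/-! ## §2 The embedding of a triple in INTRINSIC position is a linear rigidification -/

section Rigidification

variable {H₀ Z₀ : Scheme.{0}} (p₀ : Z₀ ⟶ H₀) {J : Type} (ι₀ : Z₀ ⟶ projectiveSpaceInt J)
  {g N : ℕ} {δ : Fin g → ℕ} (κ : Fin (6 ^ g * polarizationDegree δ) ≃ Fin (Nat.card J + 1))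
  (u₀ : freeModule H₀ (Fin (6 ^ g * polarizationDegree δ)) ⟶
    (Scheme.Modules.pushforward p₀).obj (twistMod ι₀ (unitModule Z₀) 1))
  (hu₀ : ∀ (k : Fin (6 ^ g * polarizationDegree δ)) (V : H₀.Opens), u₀.app V (freeSectionOn H₀ k V) =
    ((Scheme.Modules.pushforward p₀).obj (twistMod ι₀ (unitModule Z₀) 1)).presheaf.map (homOfLE (le_top : V ≤ ⊤)).op
      (monomialSection ι₀ 1 fun _ => κ k))
  {T : Scheme.{0}} [IsLocallyNoetherian T] (P : PolarizedAbelianSchemeWithLevel g N δ T)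
  {b : T ⟶ H₀} (prb : P.A.X.left ⟶ Z₀) (sqb : IsPullback prb P.A.X.hom p₀ b)
  (Γ₁ : P.A.X.left ⟶ P.A.prodLeft P.D.hat) (hΓ₁₁ : Γ₁ ≫ pullback.fst P.A.X.hom P.D.hat.X.hom = 𝟙 _)
  (hΓ₁₂ : Γ₁ ≫ pullback.snd P.A.X.hom P.D.hat.X.hom = P.pol.lam.left)
  {Lb : P.A.left.Modules} (eLb : Nonempty (Lb ≅ (Scheme.Modules.pullback prb).obj (twistMod ι₀ (unitModule Z₀) 1)))
  (hV : Nonempty (tensorObj Lb ((Scheme.Modules.pullback P.A.X.hom).obj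
      (Modules.dual ((Scheme.Modules.pullback P.A.unitSection).obj Lb))) ≅
    tensorPow ((Scheme.Modules.pullback Γ₁).obj P.D.P) 3))
  (hVI : IsIso ((Scheme.Modules.pullback b).map u₀ ≫ pushforwardBaseChangeHom sqb.w (twistMod ι₀ (unitModule Z₀) 1)))

include hΓ₁₁ hΓ₁₂ in
/-- The (R3) head, with the frame sections abstracted: if the basis sections of the frame `e` are `t`, and the point of `𝐏(J; T)` of
`(L, t)` read in `F` has `𝐏ⁿ_ℤ`-component `ι`, then `ι` is a linear rigidification. [cite: MumfordFogartyKirwan1994, Ch. 7 §2 Prop. 7.6 (p. 136)] -/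
private theorem isLinearRigidification_of_basisSection_eq {L : P.A.left.Modules} (hL : HasRank L 1)
    (hV' : Nonempty (tensorObj L ((Scheme.Modules.pullback P.A.X.hom).obj
        (Modules.dual ((Scheme.Modules.pullback P.A.unitSection).obj L))) ≅
      tensorPow ((Scheme.Modules.pullback Γ₁).obj P.D.P) 3))
    (F : FrameSystem L) (h1 : ∀ x, F.rank x = 1)
    (e : SheafOfModules.free (Fin (Nat.card J + 1)) ≅ ((Scheme.Modules.pushforward P.A.X.hom).obj L).over ⊤)
    (t : Fin (Nat.card J + 1) → Γ(L, ⊤)) (ht : ∀ j, basisSection e j = t j)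
    (hcov : ⨆ i, ⨆ x, P.A.X.left.basicOpen ((CocycleSections.ofFrameSystem F h1 t).coeff i x) = ⊤)
    (emb : P.A.X.left ⟶ projectiveSpaceInt J)
    (hemb : projectiveSpace.homEquiv (Over.mk P.A.X.hom)
      (projectiveSpace.pointOfSections (Over.mk P.A.X.hom) (ofCocycleSections F.U (CocycleSections.ofFrameSystem F h1 t) hcov)) =
        emb) :
    P.IsLinearRigidification J emb := by
  obtain rfl : (fun j ↦ (basisSection e j :)) = t := funext ht
  exact P.isLinearRigidification_of_homEquiv_pointOfSections_eq J Γ₁ hΓ₁₁ hΓ₁₂ hL hV' F h1 e hcov emb hemb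

include κ hu₀ sqb hΓ₁₁ hΓ₁₂ eLb hV hVI in
/-- **The embedding of a triple in INTRINSIC position is a linear rigidification** ([MumfordFogartyKirwan1994] Prop. 7.6: «`Z_H ⊂ ℙ^m × H`
is a linear rigidification of `Z_H/H` with respect to `L^Δ(λ)³`»; here for any `T`-valued point of the MFK sub-functor).  For a triple
`P` over a locally Noetherian `T`, a cartesian square `prb : P.A → Z₀` over `b : T → H₀` onto the family `p₀ : Z₀ → H₀` with its
`𝐏ⁿ_ℤ`-component `ι₀`, the graph `Γ₁ = (1, λ)`, a rank-one `L_b ≅ prb^*𝒪_{Z₀}(1)` with clause (V) «`L_b ⊗ π^*(ε^*L_b)^∨ ≅ (Γ₁^*𝒫)^{⊗3}`»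
and clause (VI) «`b^*u₀ ≫ β_b : 𝒪_T^{6^g·d} → π_*(prb^*𝒪(1))` is an isomorphism» for the coordinate frame `u₀` (letter `hu₀`), the
composite `prb ≫ ι₀ : P.A → 𝐏ⁿ_ℤ` is a ★ (8α) `IsLinearRigidification` of `P`.  Proof: ★ (R3)
`isLinearRigidification_of_homEquiv_pointOfSections_eq` at `L := 𝒪_{P.A}(1) = twistMod (prb ≫ ι₀) 𝒪 1` (rank one; `L_b ≅ L` by ★
`isIso_pullbackTwistHom`, so (V) moves by ★ `nonempty_normalised_iso_of_iso`), a rank-one frame system (★ `exists_frameSystem_of_hasRank`),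
and the global frame of `π_*𝒪(1)` obtained from (VI) followed by `π_*(L_b ≅ L)` (★ (s1)
`exists_frame_basisSection_eq_app_unitSectionLE_of_isIso`), reindexed along `κ`: its basis sections are the coordinate sections
`x_i|_{P.A}` (`hu₀`, ★ `pushforwardBaseChangeHom_app_unitSectionLE`, ★ (γ1) `pullbackTwistHom_app_unitSectionLE_monomialSection`), whose
point of `𝐏ⁿ_ℤ` in any frame system is `prb ≫ ι₀` ([Hartshorne1977] II Thm. 7.1, ★ (L1) `homEquiv_pointOfSections_ofFrameSystem_monomialSection_one`).
[cite: MumfordFogartyKirwan1994, Ch. 7 §2 Prop. 7.6 (p. 136) and Def. 7.5 (p. 130)] [cite: MumfordFogartyKirwan1994, Ch. 7 §2 Prop. 7.3, steps (V)–(VI) of the proof (p. 134)]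
[cite: Hartshorne1977, II Thm. 7.1 (p. 150)] -/
theorem isLinearRigidification_comp_of_clauses : P.IsLinearRigidification J (prb ≫ ι₀) := by
  obtain ⟨eLb⟩ := eLb
  obtain ⟨hV⟩ := hV
  haveI := hVI
  haveI := isIso_pullbackTwistHom prb ι₀ 1
  -- `L := 𝒪_{P.A}(1)` and `L_b ≅ prb^*𝒪_{Z₀}(1) ≅ L`
  have hL : HasRank (twistMod (prb ≫ ι₀) (unitModule P.A.X.left) 1) 1 := hasRank_twistMod_unitModule (prb ≫ ι₀) 1
  let eL' : (Scheme.Modules.pullback prb).obj (twistMod ι₀ (unitModule Z₀) 1) ≅ twistMod (prb ≫ ι₀) (unitModule P.A.X.left) 1 :=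
    asIso (pullbackTwistHom prb ι₀ 1)
  have eL : Lb ≅ twistMod (prb ≫ ι₀) (unitModule P.A.X.left) 1 := eLb ≪≫ eL'
  have hLb : HasRank Lb 1 := hasRank_of_iso eL.symm hL
  -- clause (V) moved to `L`
  obtain ⟨n⟩ := nonempty_normalised_iso_of_iso P.A eL hLb
  have hV' : Nonempty (tensorObj (twistMod (prb ≫ ι₀) (unitModule P.A.X.left) 1)
      ((Scheme.Modules.pullback P.A.X.hom).obj (Modules.dual ((Scheme.Modules.pullback P.A.unitSection).obj
        (twistMod (prb ≫ ι₀) (unitModule P.A.X.left) 1)))) ≅ tensorPow ((Scheme.Modules.pullback Γ₁).obj P.D.P) 3) :=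
    ⟨n.symm ≪≫ hV⟩
  -- a rank-one frame system of `L`
  obtain ⟨F, h1⟩ := exists_frameSystem_of_hasRank hL
  -- the global frame of `π_*L` from (VI): `𝒪_T^{6^g·d} ≅ b^*𝒪^{6^g·d} → π_*(prb^*𝒪(1)) → π_*L`
  let β : (Scheme.Modules.pullback b).obj ((Scheme.Modules.pushforward p₀).obj (twistMod ι₀ (unitModule Z₀) 1)) ⟶
      (Scheme.Modules.pushforward P.A.X.hom).obj (twistMod (prb ≫ ι₀) (unitModule P.A.X.left) 1) :=
    pushforwardBaseChangeHom sqb.w (twistMod ι₀ (unitModule Z₀) 1) ≫ (Scheme.Modules.pushforward P.A.X.hom).map eL'.hom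
  haveI : IsIso ((Scheme.Modules.pullback b).map u₀ ≫ β) := by
    rw [← Category.assoc]; infer_instance
  obtain ⟨e', he'⟩ := exists_frame_basisSection_eq_app_unitSectionLE_of_isIso u₀ b β
  -- its basis sections are the coordinate sections `x_{κ k}|_{P.A}`
  have he'' : ∀ k, basisSection e' k =
      (show Γ((Scheme.Modules.pushforward P.A.X.hom).obj (twistMod (prb ≫ ι₀) (unitModule P.A.X.left) 1), ⊤) from
        monomialSection (prb ≫ ι₀) 1 fun _ => κ k) := by
    intro k
    rw [he']
    have hk : u₀.app ⊤ (freeSectionOn H₀ k ⊤) = monomialSection ι₀ 1 fun _ => κ k := by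
      rw [hu₀ k ⊤]
      exact map_id_apply _ _
    rw [hk]
    change ((Scheme.Modules.pushforward P.A.X.hom).map eL'.hom).app ⊤
      ((pushforwardBaseChangeHom sqb.w (twistMod ι₀ (unitModule Z₀) 1)).app ⊤
        (unitSectionLE b ((Scheme.Modules.pushforward p₀).obj (twistMod ι₀ (unitModule Z₀) 1)) (V := ⊤) (U := ⊤) le_top
          (show Γ((Scheme.Modules.pushforward p₀).obj (twistMod ι₀ (unitModule Z₀) 1), ⊤) from
            (monomialSection ι₀ 1 fun _ => κ k : Γ(twistMod ι₀ (unitModule Z₀) 1, p₀ ⁻¹ᵁ ⊤))))) = _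
    rw [pushforwardBaseChangeHom_app_unitSectionLE, Scheme.Modules.pushforward_map_app]
    exact pullbackTwistHom_app_unitSectionLE_monomialSection prb ι₀ 1 fun _ => κ k
  -- reindex along `κ`
  obtain ⟨e, he⟩ := exists_frame_reindex κ.symm e'
  have he₁ : ∀ i, basisSection e i =
      (show Γ((Scheme.Modules.pushforward P.A.X.hom).obj (twistMod (prb ≫ ι₀) (unitModule P.A.X.left) 1), ⊤) from
        monomialSection (prb ≫ ι₀) 1 fun _ : Fin 1 => i) := fun i => by
    rw [he i, he'', Equiv.apply_symm_apply]
  -- [Hartshorne1977] II Thm. 7.1: the point of the coordinate sections is the embedding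
  obtain ⟨hcov, hemb⟩ := homEquiv_pointOfSections_ofFrameSystem_monomialSection_one (J := J) (prb ≫ ι₀) F h1 P.A.X.hom
  exact isLinearRigidification_of_basisSection_eq P Γ₁ hΓ₁₁ hΓ₁₂ hL hV' F h1 e
    (fun i : Fin (Nat.card J + 1) => monomialSection (prb ≫ ι₀) 1 fun _ : Fin 1 => i) he₁ hcov (prb ≫ ι₀) hemb

end Rigidification

/-! ## §3 HEAD — the universal triple of the MFK sub-functor and its `T`-points -/

section Head

variable {H₀ Z₀ : Scheme.{0}} (f₀ : H₀ ⟶ Spec (.of ℚ)) [LocallyOfFiniteType f₀]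
  {J : Type} [Finite J] (p₀ : Z₀ ⟶ H₀) (ι₀ : Z₀ ⟶ projectiveSpaceInt J)
  (i₀ : Z₀ ⟶ projectiveSpace J H₀) [IsClosedImmersion i₀] (hp₀ : i₀ ≫ projectiveSpaceFst J H₀ = p₀)
  (hι₀ : i₀ ≫ pullback.snd (terminal.from H₀) (terminal.from (projectiveSpaceInt J)) = ι₀) [Flat p₀]
  (ε₀ : H₀ ⟶ Z₀) (hε₀ : ε₀ ≫ p₀ = 𝟙 H₀) {g : ℕ}
  (τ₀ : Fin g ⊕ Fin g → (H₀ ⟶ Z₀)) (hτ₀ : ∀ i, τ₀ i ≫ p₀ = 𝟙 H₀)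
  {N : ℕ} (hN : N ≠ 0) (δ : Fin g → ℕ) (hδ : IsPolarizationType δ)
  (κ : Fin (6 ^ g * polarizationDegree δ) ≃ Fin (Nat.card J + 1))
  (u₀ : freeModule H₀ (Fin (6 ^ g * polarizationDegree δ)) ⟶
    (Scheme.Modules.pushforward p₀).obj (twistMod ι₀ (unitModule Z₀) 1))
  (hu₀ : ∀ (k : Fin (6 ^ g * polarizationDegree δ)) (V : H₀.Opens), u₀.app V (freeSectionOn H₀ k V) =
    ((Scheme.Modules.pushforward p₀).obj (twistMod ι₀ (unitModule Z₀) 1)).presheaf.map (homOfLE (le_top : V ≤ ⊤)).op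
      (monomialSection ι₀ 1 fun _ => κ k))
  -- `hII` (step (II), [MumfordFogartyKirwan1994] Thm. 6.14 with the group law as output DATA; letter of ★ FILE 2)
  (hII : ∀ ⦃H₁ Z₁ : Scheme.{0}⦄ (p₁ : Z₁ ⟶ H₁) [IsProper p₁] [Smooth p₁] [GeometricallyConnected p₁]
      (f₁ : H₁ ⟶ Spec (.of ℚ)) [LocallyOfFiniteType f₁] (ε₁ : H₁ ⟶ Z₁) (_ : ε₁ ≫ p₁ = 𝟙 H₁),
    ∃ (H₂ : Scheme.{0}) (j₂ : H₂ ⟶ H₁) (_ : IsOpenImmersion j₂) (_ : IsClosed (Set.range j₂))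
      (G : GrpObj (Over.mk (pullback.snd p₁ j₂))),
        (@MonObj.one _ _ _ (Over.mk (pullback.snd p₁ j₂)) G.toMonObj).left ≫ pullback.fst p₁ j₂ = j₂ ≫ ε₁ ∧
        SmoothOfRelativeDimension g (pullback.snd p₁ j₂) ∧
        ∀ ⦃T : Scheme.{0}⦄ (v : T ⟶ H₁),
          (∃! w : T ⟶ H₂, w ≫ j₂ = v) ↔
            ∃ G' : GrpObj (Over.mk (pullback.snd p₁ v)),
              (@MonObj.one _ _ _ (Over.mk (pullback.snd p₁ v)) G'.toMonObj).left ≫ pullback.fst p₁ v = v ≫ ε₁ ∧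
              SmoothOfRelativeDimension g (pullback.snd p₁ v))
  -- `hII′` (edition 4; step (II) for PROJECTIVE smooth families — [MumfordFogartyKirwan1994] Thm. 6.14 as printed; letter of ★ FILE 2 ed. 2)
  (hII' : ∀ ⦃H₁ Z₁ : Scheme.{0}⦄ (p₁ : Z₁ ⟶ H₁) [IsProper p₁] [Smooth p₁] [GeometricallyConnected p₁] (_ : IsProjective p₁)
      (f₁ : H₁ ⟶ Spec (.of ℚ)) [LocallyOfFiniteType f₁] (ε₁ : H₁ ⟶ Z₁) (_ : ε₁ ≫ p₁ = 𝟙 H₁),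
    ∃ (H₂ : Scheme.{0}) (j₂ : H₂ ⟶ H₁) (_ : IsOpenImmersion j₂)
      (G : GrpObj (Over.mk (pullback.snd p₁ j₂))),
        (@MonObj.one _ _ _ (Over.mk (pullback.snd p₁ j₂)) G.toMonObj).left ≫ pullback.fst p₁ j₂ = j₂ ≫ ε₁ ∧
        SmoothOfRelativeDimension g (pullback.snd p₁ j₂) ∧
        ∀ ⦃T : Scheme.{0}⦄ (v : T ⟶ H₁),
          (∃! w : T ⟶ H₂, w ≫ j₂ = v) ↔
            ∃ G' : GrpObj (Over.mk (pullback.snd p₁ v)),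
              (@MonObj.one _ _ _ (Over.mk (pullback.snd p₁ v)) G'.toMonObj).left ≫ pullback.fst p₁ v = v ≫ ε₁ ∧
              SmoothOfRelativeDimension g (pullback.snd p₁ v))
  -- `hF3` (pen (L), [MumfordFogartyKirwan1994] Cor. 6.8 Zariski-locally on the base; letter of ★ FILE 2)
  (hF3 : ∀ ⦃S : Scheme.{0}⦄ [IsLocallyNoetherian S] (fS : S ⟶ Spec (.of ℚ)) (A : AbelianSchemeOver S),
    (∀ s : S, ∃ (U : Scheme.{0}) (i : U ⟶ S) (_ : IsOpenImmersion i) (_ : s ∈ Set.range i.base)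
        (B : AbelianSchemeOver U) (G : B.X.left ⟶ A.X.left), B.IsBaseChangeVia A i G ∧ IsProjective B.X.hom) →
      Nonempty A.DualPair)
  -- `hF3′` (edition 4; [MumfordFogartyKirwan1994] Ch. 0 §5 (d) (pp. 24–25, locally Noetherian base) + Cor. 6.8 (p. 118; 6.7–6.8 are local on `S`) VERBATIM —
  -- the dual of a PROJECTIVE abelian scheme — over locally Noetherian `ℚ`-bases; letter of ★ FILE 2 ed. 2; REF1 (g13) m17 ≤-print ✓)
  (hF3' : ∀ ⦃S : Scheme.{0}⦄ [IsLocallyNoetherian S] (_ : S ⟶ Spec (.of ℚ)) (A : AbelianSchemeOver S),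
    IsProjective A.X.hom → Nonempty A.DualPair)

include f₀ i₀ hp₀ hι₀ hε₀ hτ₀ hN hδ κ hu₀ hII hF3 in
/-- **[MumfordFogartyKirwan1994] Prop. 7.3 with Prop. 7.6 — THE UNIVERSAL TRIPLE OF THE MFK SUB-FUNCTOR, from raw data.**  For a
closed flat family `i₀ : Z₀ ⊂ 𝐏(J; H₀)` (components `p₀`, `ι₀`) over a base locally of finite type over `ℚ`, sections `ε₀, τ₀`,
the binders `hII` (Thm. 6.14) and `hF3` (Cor. 6.8), a reindexing `κ` and the coordinate frame `u₀` of `(p₀)_*𝒪_{Z₀}(1)` (letter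
`hu₀`), there are: an IMMERSION `jH : H ⟶ H₀`; a polarised abelian scheme with level structure `P` over `H`
(★ `PolarizedAbelianSchemeWithLevel`) whose dual pair carries the unit hypothesis; a CARTESIAN SQUARE `sqH : P.A → Z₀` over `jH`
(the family of `P` IS `Z₀ ×_{H₀} H`) under which the unit of `P.A` is `ε₀|_H` and the level sections are the `τ₀ i|_H`; the
embedding `prH ≫ ι₀ : P.A → 𝐏ⁿ_ℤ` is a ★ (8α) LINEAR RIGIDIFICATION of `P` (Prop. 7.6); and, for every locally Noetherian `T` and
`b : T ⟶ H₀`, `b` factors (uniquely) through `jH` iff `INT(b)` — the fibres of `Z₀ ×_{H₀} T → T` are smooth and geometrically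
connected and some abelian scheme `A_b/T` on a cartesian square over `p₀` along `b`, with unit `ε₀|_T`, sections `τ₀|_T`, a
rigidified dual pair and a rank-one `L_b ≅ 𝒪_{Z₀}(1)|_{A_b}`, satisfies the clauses (V)/(P)/(III)(IV)(V′)/(VI) of Prop. 7.3 over `T`
(the letters of ★ `existsUnique_comp_iff_mfkIntrinsic` at `L₀ := twistMod ι₀ 𝒪 1`).  Assembly: ★ FILE 2
`exists_isImmersion_iff_mfkSubfunctor` (with `hamp₂` from §1), `jH := j ≫ j₂ ≫ j₁`, the clauses at `b := jH` (★ FILE 3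
`mfkIntrinsic_of_existsUnique_comp`) packaged as `P`, §2, and ★ `existsUnique_comp_iff_mfkIntrinsic`.
[cite: MumfordFogartyKirwan1994, Ch. 7 §2 Proposition 7.3 (pp. 132–134)] [cite: MumfordFogartyKirwan1994, Ch. 7 §2 Prop. 7.6 (p. 136)]
[cite: MumfordFogartyKirwan1994, Ch. 6 §3 Theorem 6.14 (p. 124)] [cite: MumfordFogartyKirwan1994, Ch. 6 §1 Corollary 6.8 (p. 118)] -/
theorem exists_siegelUniversalTriple_iff_mfkIntrinsic :
    ∃ (H : Scheme.{0}) (jH : H ⟶ H₀) (_ : IsImmersion jH)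
      (P : PolarizedAbelianSchemeWithLevel g N δ H)
      (_ : Nonempty ((Scheme.Modules.pullback (DualPair.unitHatSlice P.D)).obj P.D.P ≅ SheafOfModules.unit _))
      (prH : P.A.X.left ⟶ Z₀) (_ : IsPullback prH P.A.X.hom p₀ jH)
      (_ : P.A.unitSection ≫ prH = jH ≫ ε₀) (_ : ∀ i, (P.level.σ i).left ≫ prH = jH ≫ τ₀ i)
      (_ : P.IsLinearRigidification J (prH ≫ ι₀)),
      ∀ ⦃T : Scheme.{0}⦄ [IsLocallyNoetherian T] (b : T ⟶ H₀),
        (∃! w : T ⟶ H, w ≫ jH = b) ↔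
          (Smooth (pullback.snd p₀ b) ∧ GeometricallyConnected (pullback.snd p₀ b) ∧
          ∃ (Ab : AbelianSchemeOver T) (prb : Ab.X.left ⟶ Z₀) (sqb : IsPullback prb Ab.X.hom p₀ b)
            (_ : Ab.IsOfRelDim g) (_ : Ab.unitSection ≫ prb = b ≫ ε₀)
            (σb : Fin g ⊕ Fin g → Ab.Sections) (_ : ∀ i, (σb i).left ≫ prb = b ≫ τ₀ i)
            (Db : Ab.DualPair)
            (_ : Nonempty ((Scheme.Modules.pullback (DualPair.unitHatSlice Db)).obj Db.P ≅ SheafOfModules.unit _))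
            (Lb : Ab.left.Modules) (_ : Nonempty (Lb ≅ (Scheme.Modules.pullback prb).obj (twistMod ι₀ (unitModule Z₀) 1)))
            (ω : Ab.X ⟶ Db.hat.X) (Γ₁ : Ab.left ⟶ Ab.prodLeft Db.hat),
            IsMonHom ω ∧
              (∀ ⦃U : Over T⦄ (a : U ⟶ Ab.X),
                Nonempty ((Scheme.Modules.pullback (Ab.X ◁ (a ≫ ((𝟙 Ab.X) ^ 6) ≫ ω)).left).obj Db.P ≅
                  (Scheme.Modules.pullback (Ab.X ◁ a).left).obj (Ab.mumfordBundle
                    (tensorObj Lb ((Scheme.Modules.pullback Ab.X.hom).obj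
                      (Modules.dual ((Scheme.Modules.pullback Ab.unitSection).obj Lb))))))) ∧
              Γ₁ ≫ pullback.fst Ab.X.hom Db.hat.X.hom = 𝟙 _ ∧
              Γ₁ ≫ pullback.snd Ab.X.hom Db.hat.X.hom = ω.left ∧
              Nonempty (tensorObj Lb ((Scheme.Modules.pullback Ab.X.hom).obj
                  (Modules.dual ((Scheme.Modules.pullback Ab.unitSection).obj Lb))) ≅
                tensorPow ((Scheme.Modules.pullback Γ₁).obj Db.P) 3) ∧
              ∃ pol : Ab.Polarization Db, pol.lam = ω ∧ pol.HasType δ ∧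
                (∃ φ : LevelStructure g N Ab, (∀ i, φ.σ i = σb i) ∧ φ.IsSymplecticLiftable pol δ) ∧
                IsIso ((Scheme.Modules.pullback b).map u₀ ≫
                  pushforwardBaseChangeHom sqb.w (twistMod ι₀ (unitModule Z₀) 1))) := by
  subst hp₀ hι₀
  -- the family is projective, `𝒪(1)` has rank one
  have hproj : IsProjective (i₀ ≫ projectiveSpaceFst J H₀) :=
    (isProjective_projectiveSpaceFst J H₀).comp_isClosedImmersion i₀
  haveI : IsProper (i₀ ≫ projectiveSpaceFst J H₀) := hproj.isProper
  have hL₀ : HasRank (twistMod (i₀ ≫ pullback.snd (terminal.from H₀) (terminal.from (projectiveSpaceInt J)))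
      (unitModule Z₀) 1) 1 := hasRank_twistMod_unitModule _ 1
  -- ★ FILE 2: storeys (I), (II) and the tower over `H₂`
  obtain ⟨H₁, j₁, hj₁, H₂, j₂, hj₂, A₂, pr₂, sq₂, hA₂, hunit₂, σ₂, hσ₂, D₂, hD₂, eF, hrep₁, hrep₂, htower⟩ :=
    exists_isImmersion_iff_mfkSubfunctor f₀ (i₀ ≫ projectiveSpaceFst J H₀) hproj ε₀ hε₀ τ₀ hτ₀ _ hL₀ hN δ hδ u₀ hII hF3
  haveI := hj₁
  haveI := hj₂
  -- the (P)-closer letter is discharged (§1), hence the tower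
  obtain ⟨lam, hlamM, hlam, H, j, hj, h⟩ :=
    htower (forall_fibre_exists_isAmple_pullback_twistMod_one_iso i₀ A₂ pr₂ sq₂)
  haveI : IsImmersion j := hj
  -- `H` is locally Noetherian (locally of finite type over `ℚ`)
  haveI : IsLocallyNoetherian H := LocallyOfFiniteType.isLocallyNoetherian ((j ≫ j₂ ≫ j₁) ≫ f₀)
  -- the clauses at `b := jH`, `w := 𝟙`
  haveI : Mono (j ≫ j₂ ≫ j₁) := mono_comp _ _
  obtain ⟨-, -, Ab, prb, sqb, hgb, hunitb, σb, hσb, Db, hDb, Lb, eLb, ω, Γ₁, hωm, -, hΓ₁₁, hΓ₁₂, hV, pol, hpol, hT,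
      ⟨φ, hφ, hLift⟩, hVI⟩ :=
    mfkIntrinsic_of_existsUnique_comp (i₀ ≫ projectiveSpaceFst J H₀) ε₀ τ₀ _ δ u₀ j₁ j₂ j A₂ pr₂ sq₂ hA₂ hunit₂ σ₂ hσ₂
      D₂ hD₂ hL₀ eF lam hlam hrep₁ h (j ≫ j₂ ≫ j₁)
      ⟨𝟙 _, Category.id_comp _, fun w hw => (cancel_mono (j ≫ j₂ ≫ j₁)).1 (hw.trans (Category.id_comp _).symm)⟩
  subst hpol
  -- the universal triple
  let P : PolarizedAbelianSchemeWithLevel g N δ H :=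
    { A := Ab, relDim := hgb, D := Db, pol := pol, hasType := hT, level := φ, symplectic := hLift,
      hatNormalised := hDb }
  refine ⟨H, j ≫ j₂ ≫ j₁, inferInstance, P, hDb, prb, sqb, hunitb, fun i => ?_, ?_, fun T _ b => ?_⟩
  · -- level sections
    change (φ.σ i).left ≫ prb = _
    rw [hφ i]
    exact hσb i
  · -- Prop. 7.6: the embedding is a linear rigidification (§2)
    exact isLinearRigidification_comp_of_clauses (i₀ ≫ projectiveSpaceFst J H₀) _ κ u₀ hu₀ P prb sqb Γ₁ hΓ₁₁ hΓ₁₂ eLb hV hVI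
  · -- the `T`-points
    exact existsUnique_comp_iff_mfkIntrinsic (i₀ ≫ projectiveSpaceFst J H₀) ε₀ τ₀ _ δ u₀ j₁ j₂ j A₂ pr₂ sq₂ hA₂ hunit₂ σ₂ hσ₂
      D₂ hD₂ hL₀ eF lam hlam hrep₁ hrep₂ h b

/-! ## §4 The universal triple WITH its own clause letters (the comparison data of the representability proof) -/

include f₀ i₀ hp₀ hι₀ hε₀ hτ₀ hN hδ κ hu₀ hII hF3 in
/-- **THE UNIVERSAL TRIPLE WITH ITS OWN CLAUSE LETTERS** (the comparison data of [MumfordFogartyKirwan1994] Prop. 7.6's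
representability proof, «`Φ` injective»): the same `H`, `jH`, `P`, square and linear rigidification as
`exists_siegelUniversalTriple_iff_mfkIntrinsic`, TOGETHER WITH the clause letters of Prop. 7.3 for `P` ITSELF — a rank-one
`L_H ≅ 𝒪_{Z₀}(1)|_{P.A}`, the graph `Γ₁ = (1, λ)` of `P.pol`, the classification letter (P) «`[6] ≫ λ` classifies `Λ(L_H ⊗ π^*(ε^*L_H)^∨)`»,
clause (V) «`L_H ⊗ π^*(ε^*L_H)^∨ ≅ (Γ₁^*𝒫)^{⊗3}`» and clause (VI) «`jH^*u₀ ≫ β` is an isomorphism» — and the `T`-points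
`(∃! w, w ≫ jH = b) ↔ INT(b)`.  These are the components of `INT(jH)` (★ FILE 3 `mfkIntrinsic_of_existsUnique_comp` at `w := 𝟙`) read
on the triple they define (re-deriving `INT(jH)` from the `T`-point clause would produce a FRESH abelian scheme, not `P.A`); the
(H-rep) comparison `(G, Ĝ)` of a linearly rigidified triple with `P` is built from them.
[cite: MumfordFogartyKirwan1994, Ch. 7 §2 Proposition 7.3 (pp. 132–134)] [cite: MumfordFogartyKirwan1994, Ch. 7 §2 Prop. 7.6 (p. 136)]
[cite: MumfordFogartyKirwan1994, Ch. 6 §3 Theorem 6.14 (p. 124)] [cite: MumfordFogartyKirwan1994, Ch. 6 §1 Corollary 6.8 (p. 118)] -/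
theorem exists_siegelUniversalTriple_clauses_iff_mfkIntrinsic :
    ∃ (H : Scheme.{0}) (jH : H ⟶ H₀) (_ : IsImmersion jH)
      (P : PolarizedAbelianSchemeWithLevel g N δ H)
      (_ : Nonempty ((Scheme.Modules.pullback (DualPair.unitHatSlice P.D)).obj P.D.P ≅ SheafOfModules.unit _))
      (prH : P.A.X.left ⟶ Z₀) (sqH : IsPullback prH P.A.X.hom p₀ jH)
      (_ : P.A.unitSection ≫ prH = jH ≫ ε₀) (_ : ∀ i, (P.level.σ i).left ≫ prH = jH ≫ τ₀ i)
      (_ : P.IsLinearRigidification J (prH ≫ ι₀))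
      (LH : P.A.left.Modules) (_ : Nonempty (LH ≅ (Scheme.Modules.pullback prH).obj (twistMod ι₀ (unitModule Z₀) 1)))
      (Γ₁ : P.A.left ⟶ P.A.prodLeft P.D.hat),
      (∀ ⦃U : Over H⦄ (a : U ⟶ P.A.X),
        Nonempty ((Scheme.Modules.pullback (P.A.X ◁ (a ≫ ((𝟙 P.A.X) ^ 6) ≫ P.pol.lam)).left).obj P.D.P ≅
          (Scheme.Modules.pullback (P.A.X ◁ a).left).obj (P.A.mumfordBundle
            (tensorObj LH ((Scheme.Modules.pullback P.A.X.hom).obj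
              (Modules.dual ((Scheme.Modules.pullback P.A.unitSection).obj LH))))))) ∧
      Γ₁ ≫ pullback.fst P.A.X.hom P.D.hat.X.hom = 𝟙 _ ∧
      Γ₁ ≫ pullback.snd P.A.X.hom P.D.hat.X.hom = P.pol.lam.left ∧
      Nonempty (tensorObj LH ((Scheme.Modules.pullback P.A.X.hom).obj
          (Modules.dual ((Scheme.Modules.pullback P.A.unitSection).obj LH))) ≅
        tensorPow ((Scheme.Modules.pullback Γ₁).obj P.D.P) 3) ∧
      IsIso ((Scheme.Modules.pullback jH).map u₀ ≫ pushforwardBaseChangeHom sqH.w (twistMod ι₀ (unitModule Z₀) 1)) ∧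
      ∀ ⦃T : Scheme.{0}⦄ [IsLocallyNoetherian T] (b : T ⟶ H₀),
        (∃! w : T ⟶ H, w ≫ jH = b) ↔
          (Smooth (pullback.snd p₀ b) ∧ GeometricallyConnected (pullback.snd p₀ b) ∧
          ∃ (Ab : AbelianSchemeOver T) (prb : Ab.X.left ⟶ Z₀) (sqb : IsPullback prb Ab.X.hom p₀ b)
            (_ : Ab.IsOfRelDim g) (_ : Ab.unitSection ≫ prb = b ≫ ε₀)
            (σb : Fin g ⊕ Fin g → Ab.Sections) (_ : ∀ i, (σb i).left ≫ prb = b ≫ τ₀ i)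
            (Db : Ab.DualPair)
            (_ : Nonempty ((Scheme.Modules.pullback (DualPair.unitHatSlice Db)).obj Db.P ≅ SheafOfModules.unit _))
            (Lb : Ab.left.Modules) (_ : Nonempty (Lb ≅ (Scheme.Modules.pullback prb).obj (twistMod ι₀ (unitModule Z₀) 1)))
            (ω : Ab.X ⟶ Db.hat.X) (Γ₁ : Ab.left ⟶ Ab.prodLeft Db.hat),
            IsMonHom ω ∧
              (∀ ⦃U : Over T⦄ (a : U ⟶ Ab.X),
                Nonempty ((Scheme.Modules.pullback (Ab.X ◁ (a ≫ ((𝟙 Ab.X) ^ 6) ≫ ω)).left).obj Db.P ≅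
                  (Scheme.Modules.pullback (Ab.X ◁ a).left).obj (Ab.mumfordBundle
                    (tensorObj Lb ((Scheme.Modules.pullback Ab.X.hom).obj
                      (Modules.dual ((Scheme.Modules.pullback Ab.unitSection).obj Lb))))))) ∧
              Γ₁ ≫ pullback.fst Ab.X.hom Db.hat.X.hom = 𝟙 _ ∧
              Γ₁ ≫ pullback.snd Ab.X.hom Db.hat.X.hom = ω.left ∧
              Nonempty (tensorObj Lb ((Scheme.Modules.pullback Ab.X.hom).obj
                  (Modules.dual ((Scheme.Modules.pullback Ab.unitSection).obj Lb))) ≅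
                tensorPow ((Scheme.Modules.pullback Γ₁).obj Db.P) 3) ∧
              ∃ pol : Ab.Polarization Db, pol.lam = ω ∧ pol.HasType δ ∧
                (∃ φ : LevelStructure g N Ab, (∀ i, φ.σ i = σb i) ∧ φ.IsSymplecticLiftable pol δ) ∧
                IsIso ((Scheme.Modules.pullback b).map u₀ ≫
                  pushforwardBaseChangeHom sqb.w (twistMod ι₀ (unitModule Z₀) 1))) := by
  subst hp₀ hι₀
  have hproj : IsProjective (i₀ ≫ projectiveSpaceFst J H₀) :=
    (isProjective_projectiveSpaceFst J H₀).comp_isClosedImmersion i₀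
  haveI : IsProper (i₀ ≫ projectiveSpaceFst J H₀) := hproj.isProper
  have hL₀ : HasRank (twistMod (i₀ ≫ pullback.snd (terminal.from H₀) (terminal.from (projectiveSpaceInt J)))
      (unitModule Z₀) 1) 1 := hasRank_twistMod_unitModule _ 1
  obtain ⟨H₁, j₁, hj₁, H₂, j₂, hj₂, A₂, pr₂, sq₂, hA₂, hunit₂, σ₂, hσ₂, D₂, hD₂, eF, hrep₁, hrep₂, htower⟩ :=
    exists_isImmersion_iff_mfkSubfunctor f₀ (i₀ ≫ projectiveSpaceFst J H₀) hproj ε₀ hε₀ τ₀ hτ₀ _ hL₀ hN δ hδ u₀ hII hF3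
  haveI := hj₁
  haveI := hj₂
  obtain ⟨lam, hlamM, hlam, H, j, hj, h⟩ :=
    htower (forall_fibre_exists_isAmple_pullback_twistMod_one_iso i₀ A₂ pr₂ sq₂)
  haveI : IsImmersion j := hj
  haveI : IsLocallyNoetherian H := LocallyOfFiniteType.isLocallyNoetherian ((j ≫ j₂ ≫ j₁) ≫ f₀)
  haveI : Mono (j ≫ j₂ ≫ j₁) := mono_comp _ _
  obtain ⟨-, -, Ab, prb, sqb, hgb, hunitb, σb, hσb, Db, hDb, Lb, eLb, ω, Γ₁, hωm, hlet, hΓ₁₁, hΓ₁₂, hV, pol, hpol, hT,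
      ⟨φ, hφ, hLift⟩, hVI⟩ :=
    mfkIntrinsic_of_existsUnique_comp (i₀ ≫ projectiveSpaceFst J H₀) ε₀ τ₀ _ δ u₀ j₁ j₂ j A₂ pr₂ sq₂ hA₂ hunit₂ σ₂ hσ₂
      D₂ hD₂ hL₀ eF lam hlam hrep₁ h (j ≫ j₂ ≫ j₁)
      ⟨𝟙 _, Category.id_comp _, fun w hw => (cancel_mono (j ≫ j₂ ≫ j₁)).1 (hw.trans (Category.id_comp _).symm)⟩
  subst hpol
  let P : PolarizedAbelianSchemeWithLevel g N δ H :=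
    { A := Ab, relDim := hgb, D := Db, pol := pol, hasType := hT, level := φ, symplectic := hLift,
      hatNormalised := hDb }
  refine ⟨H, j ≫ j₂ ≫ j₁, inferInstance, P, hDb, prb, sqb, hunitb, fun i => ?_, ?_, Lb, eLb, Γ₁, hlet, hΓ₁₁, hΓ₁₂, hV, hVI,
    fun T _ b => ?_⟩
  · change (φ.σ i).left ≫ prb = _
    rw [hφ i]
    exact hσb i
  · exact isLinearRigidification_comp_of_clauses (i₀ ≫ projectiveSpaceFst J H₀) _ κ u₀ hu₀ P prb sqb Γ₁ hΓ₁₁ hΓ₁₂ eLb hV hVI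
  · exact existsUnique_comp_iff_mfkIntrinsic (i₀ ≫ projectiveSpaceFst J H₀) ε₀ τ₀ _ δ u₀ j₁ j₂ j A₂ pr₂ sq₂ hA₂ hunit₂ σ₂ hσ₂
      D₂ hD₂ hL₀ eF lam hlam hrep₁ hrep₂ h b

/-! ## §5 (Edition 4) The same over the `≤`-print step-(II) letter `hII′` (`IsProjective p₁`, [MumfordFogartyKirwan1994] Thm. 6.14 as printed) -/

include f₀ i₀ hp₀ hι₀ hε₀ hτ₀ hN hδ κ hu₀ hII' hF3' in
/-- **Edition 4 — THE UNIVERSAL TRIPLE WITH ITS OWN CLAUSE LETTERS, over the `≤`-print letters `hII′` (step (II)) and `hF3′` (Cor. 6.8)** (the binders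
carry `IsProjective` as [MumfordFogartyKirwan1994] Thm. 6.14 ∕ Prop. 7.3 (II) ∕ Cor. 6.8 print it; ★ FILE 2 ed. 2 `exists_isImmersion_iff_mfkSubfunctor'`
discharges it at the projective `Z₀ ×_{H₀} H₁ → H₁`; explicit arguments = the edition-2 head's with `hII ↦ hII′`, `hF3 ↦ hF3′`).  Otherwise VERBATIM: (the comparison data of [MumfordFogartyKirwan1994] Prop. 7.6's
representability proof, «`Φ` injective»): the same `H`, `jH`, `P`, square and linear rigidification as
`exists_siegelUniversalTriple_iff_mfkIntrinsic`, TOGETHER WITH the clause letters of Prop. 7.3 for `P` ITSELF — a rank-one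
`L_H ≅ 𝒪_{Z₀}(1)|_{P.A}`, the graph `Γ₁ = (1, λ)` of `P.pol`, the classification letter (P) «`[6] ≫ λ` classifies `Λ(L_H ⊗ π^*(ε^*L_H)^∨)`»,
clause (V) «`L_H ⊗ π^*(ε^*L_H)^∨ ≅ (Γ₁^*𝒫)^{⊗3}`» and clause (VI) «`jH^*u₀ ≫ β` is an isomorphism» — and the `T`-points
`(∃! w, w ≫ jH = b) ↔ INT(b)`.  These are the components of `INT(jH)` (★ FILE 3 `mfkIntrinsic_of_existsUnique_comp` at `w := 𝟙`) read
on the triple they define (re-deriving `INT(jH)` from the `T`-point clause would produce a FRESH abelian scheme, not `P.A`); the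
(H-rep) comparison `(G, Ĝ)` of a linearly rigidified triple with `P` is built from them.
[cite: MumfordFogartyKirwan1994, Ch. 7 §2 Proposition 7.3 (pp. 132–134)] [cite: MumfordFogartyKirwan1994, Ch. 7 §2 Prop. 7.6 (p. 136)]
[cite: MumfordFogartyKirwan1994, Ch. 6 §3 Theorem 6.14 (p. 124)] [cite: MumfordFogartyKirwan1994, Ch. 6 §1 Corollary 6.8 (p. 118)] -/
theorem exists_siegelUniversalTriple_clauses_iff_mfkIntrinsic' :
    ∃ (H : Scheme.{0}) (jH : H ⟶ H₀) (_ : IsImmersion jH)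
      (P : PolarizedAbelianSchemeWithLevel g N δ H)
      (_ : Nonempty ((Scheme.Modules.pullback (DualPair.unitHatSlice P.D)).obj P.D.P ≅ SheafOfModules.unit _))
      (prH : P.A.X.left ⟶ Z₀) (sqH : IsPullback prH P.A.X.hom p₀ jH)
      (_ : P.A.unitSection ≫ prH = jH ≫ ε₀) (_ : ∀ i, (P.level.σ i).left ≫ prH = jH ≫ τ₀ i)
      (_ : P.IsLinearRigidification J (prH ≫ ι₀))
      (LH : P.A.left.Modules) (_ : Nonempty (LH ≅ (Scheme.Modules.pullback prH).obj (twistMod ι₀ (unitModule Z₀) 1)))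
      (Γ₁ : P.A.left ⟶ P.A.prodLeft P.D.hat),
      (∀ ⦃U : Over H⦄ (a : U ⟶ P.A.X),
        Nonempty ((Scheme.Modules.pullback (P.A.X ◁ (a ≫ ((𝟙 P.A.X) ^ 6) ≫ P.pol.lam)).left).obj P.D.P ≅
          (Scheme.Modules.pullback (P.A.X ◁ a).left).obj (P.A.mumfordBundle
            (tensorObj LH ((Scheme.Modules.pullback P.A.X.hom).obj
              (Modules.dual ((Scheme.Modules.pullback P.A.unitSection).obj LH))))))) ∧
      Γ₁ ≫ pullback.fst P.A.X.hom P.D.hat.X.hom = 𝟙 _ ∧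
      Γ₁ ≫ pullback.snd P.A.X.hom P.D.hat.X.hom = P.pol.lam.left ∧
      Nonempty (tensorObj LH ((Scheme.Modules.pullback P.A.X.hom).obj
          (Modules.dual ((Scheme.Modules.pullback P.A.unitSection).obj LH))) ≅
        tensorPow ((Scheme.Modules.pullback Γ₁).obj P.D.P) 3) ∧
      IsIso ((Scheme.Modules.pullback jH).map u₀ ≫ pushforwardBaseChangeHom sqH.w (twistMod ι₀ (unitModule Z₀) 1)) ∧
      ∀ ⦃T : Scheme.{0}⦄ [IsLocallyNoetherian T] (b : T ⟶ H₀),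
        (∃! w : T ⟶ H, w ≫ jH = b) ↔
          (Smooth (pullback.snd p₀ b) ∧ GeometricallyConnected (pullback.snd p₀ b) ∧
          ∃ (Ab : AbelianSchemeOver T) (prb : Ab.X.left ⟶ Z₀) (sqb : IsPullback prb Ab.X.hom p₀ b)
            (_ : Ab.IsOfRelDim g) (_ : Ab.unitSection ≫ prb = b ≫ ε₀)
            (σb : Fin g ⊕ Fin g → Ab.Sections) (_ : ∀ i, (σb i).left ≫ prb = b ≫ τ₀ i)
            (Db : Ab.DualPair)
            (_ : Nonempty ((Scheme.Modules.pullback (DualPair.unitHatSlice Db)).obj Db.P ≅ SheafOfModules.unit _))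
            (Lb : Ab.left.Modules) (_ : Nonempty (Lb ≅ (Scheme.Modules.pullback prb).obj (twistMod ι₀ (unitModule Z₀) 1)))
            (ω : Ab.X ⟶ Db.hat.X) (Γ₁ : Ab.left ⟶ Ab.prodLeft Db.hat),
            IsMonHom ω ∧
              (∀ ⦃U : Over T⦄ (a : U ⟶ Ab.X),
                Nonempty ((Scheme.Modules.pullback (Ab.X ◁ (a ≫ ((𝟙 Ab.X) ^ 6) ≫ ω)).left).obj Db.P ≅
                  (Scheme.Modules.pullback (Ab.X ◁ a).left).obj (Ab.mumfordBundle
                    (tensorObj Lb ((Scheme.Modules.pullback Ab.X.hom).obj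
                      (Modules.dual ((Scheme.Modules.pullback Ab.unitSection).obj Lb))))))) ∧
              Γ₁ ≫ pullback.fst Ab.X.hom Db.hat.X.hom = 𝟙 _ ∧
              Γ₁ ≫ pullback.snd Ab.X.hom Db.hat.X.hom = ω.left ∧
              Nonempty (tensorObj Lb ((Scheme.Modules.pullback Ab.X.hom).obj
                  (Modules.dual ((Scheme.Modules.pullback Ab.unitSection).obj Lb))) ≅
                tensorPow ((Scheme.Modules.pullback Γ₁).obj Db.P) 3) ∧
              ∃ pol : Ab.Polarization Db, pol.lam = ω ∧ pol.HasType δ ∧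
                (∃ φ : LevelStructure g N Ab, (∀ i, φ.σ i = σb i) ∧ φ.IsSymplecticLiftable pol δ) ∧
                IsIso ((Scheme.Modules.pullback b).map u₀ ≫
                  pushforwardBaseChangeHom sqb.w (twistMod ι₀ (unitModule Z₀) 1))) := by
  subst hp₀ hι₀
  have hproj : IsProjective (i₀ ≫ projectiveSpaceFst J H₀) :=
    (isProjective_projectiveSpaceFst J H₀).comp_isClosedImmersion i₀
  haveI : IsProper (i₀ ≫ projectiveSpaceFst J H₀) := hproj.isProper
  have hL₀ : HasRank (twistMod (i₀ ≫ pullback.snd (terminal.from H₀) (terminal.from (projectiveSpaceInt J)))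
      (unitModule Z₀) 1) 1 := hasRank_twistMod_unitModule _ 1
  obtain ⟨H₁, j₁, hj₁, H₂, j₂, hj₂, A₂, pr₂, sq₂, hA₂, hunit₂, σ₂, hσ₂, D₂, hD₂, eF, hrep₁, hrep₂, htower⟩ :=
    exists_isImmersion_iff_mfkSubfunctor' f₀ (i₀ ≫ projectiveSpaceFst J H₀) hproj ε₀ hε₀ τ₀ hτ₀ _ hL₀ hN δ hδ u₀ hII' hF3'
  haveI := hj₁
  haveI := hj₂
  obtain ⟨lam, hlamM, hlam, H, j, hj, h⟩ :=
    htower (forall_fibre_exists_isAmple_pullback_twistMod_one_iso i₀ A₂ pr₂ sq₂)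
  haveI : IsImmersion j := hj
  haveI : IsLocallyNoetherian H := LocallyOfFiniteType.isLocallyNoetherian ((j ≫ j₂ ≫ j₁) ≫ f₀)
  haveI : Mono (j ≫ j₂ ≫ j₁) := mono_comp _ _
  obtain ⟨-, -, Ab, prb, sqb, hgb, hunitb, σb, hσb, Db, hDb, Lb, eLb, ω, Γ₁, hωm, hlet, hΓ₁₁, hΓ₁₂, hV, pol, hpol, hT,
      ⟨φ, hφ, hLift⟩, hVI⟩ :=
    mfkIntrinsic_of_existsUnique_comp (i₀ ≫ projectiveSpaceFst J H₀) ε₀ τ₀ _ δ u₀ j₁ j₂ j A₂ pr₂ sq₂ hA₂ hunit₂ σ₂ hσ₂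
      D₂ hD₂ hL₀ eF lam hlam hrep₁ h (j ≫ j₂ ≫ j₁)
      ⟨𝟙 _, Category.id_comp _, fun w hw => (cancel_mono (j ≫ j₂ ≫ j₁)).1 (hw.trans (Category.id_comp _).symm)⟩
  subst hpol
  let P : PolarizedAbelianSchemeWithLevel g N δ H :=
    { A := Ab, relDim := hgb, D := Db, pol := pol, hasType := hT, level := φ, symplectic := hLift,
      hatNormalised := hDb }
  refine ⟨H, j ≫ j₂ ≫ j₁, inferInstance, P, hDb, prb, sqb, hunitb, fun i => ?_, ?_, Lb, eLb, Γ₁, hlet, hΓ₁₁, hΓ₁₂, hV, hVI,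
    fun T _ b => ?_⟩
  · change (φ.σ i).left ≫ prb = _
    rw [hφ i]
    exact hσb i
  · exact isLinearRigidification_comp_of_clauses (i₀ ≫ projectiveSpaceFst J H₀) _ κ u₀ hu₀ P prb sqb Γ₁ hΓ₁₁ hΓ₁₂ eLb hV hVI
  · exact existsUnique_comp_iff_mfkIntrinsic (i₀ ≫ projectiveSpaceFst J H₀) ε₀ τ₀ _ δ u₀ j₁ j₂ j A₂ pr₂ sq₂ hA₂ hunit₂ σ₂ hσ₂
      D₂ hD₂ hL₀ eF lam hlam hrep₁ hrep₂ h b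

end Head

end Literature.AlgebraicGeometry.ModuliOfAbelianVarieties

end
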